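import Summits.AnomalousDissipation.AnomalousDissipation.Theorems.BaireTransferRobustLoudUpgradeStubLsFamilyB
import Summits.AnomalousDissipation.AnomalousDissipation.Theorems.BaireTransferRobustLoudUpgradeStubRadialPeriodic

/-!
# Stub `stub_radialSteady` of the line `malkin-cone-group-orbits` (crux stmt-AnomalousDissipation-1144, companion c4
# "the viscosity unfolding"), class R (steady): RADIAL VISIBILITY gives scaling-crossing data at the force itself

Registered stub `stub_radialSteady` (Pi-form), proved here.  Let `u₀` be a mean-zero classical steady state of
`NS_ν(f_c)` (`ν > 0`) whose classical mean-zero kernel of the linearisation `L(ν,u₀)` lies on the complex line of a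
smooth divergence-free mean-zero real field `v` ("simply degenerate"), and assume RADIAL VISIBILITY: the force itself
is not in the range, `f_c ∉ range L(ν,u₀)`.  The landed Lyapunov–Schmidt family `LsFamily.stub_lsFamily`
(`…StubLsFamilyB.lean`), run with the BORDER FIELD `h := f_c` (admissible: `SteadyPersist.isSmooth_force'`,
`isDivFree_force'`, `hasZeroMean_force'`; non-range = radial visibility), returns `σ : P_S × ℝ → ℝ` with
`σ(c,0) = 0`, a derivative `ℓ = Dσ(c,0)` passing the visibility test `ℓ(c,0) ≠ 0`, and the realisation of every
`q` near `(c,0)` by a mean-zero classical steady state of the CORRECTED force `f_{q.1} − σ(q) f_c`, `H¹`-close to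
`u₀`.  Hence (A) at the zeros of `σ` the corrected force is the uncorrected `f_{q.1}` (family-at-zeros clause), and
(B) along the ray `s ↦ σ(s • c, 0)` the function vanishes at `s = 1` with non-zero derivative `ℓ(c,0)` (line
derivative of `σ` at `(c,0)` in the direction `(c,0)`), so it takes both signs at dilation factors `s` arbitrarily
close to `1` (the elementary `ScalingCrossing.exists_ray_sign_change` of the periodic twin `…StubRadialPeriodic.lean`).
Pure proof file.
References: Chow–Hale 1982 §2.4; Kielhöfer 2012 §I.2 (Lyapunov–Schmidt); the route file (item 1144).
-/

-- `Summit.<Summit>.<Problem>` is the tree's mandated summit-side namespace (CONVENTIONS §2); for this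
-- single-conjunct summit the two coincide, so the duplicate is deliberate.
set_option linter.dupNamespace false

noncomputable section

open scoped BigOperators Topology
open Filter Set Function TopologicalSpace MeasureTheory

namespace Summit.AnomalousDissipation.AnomalousDissipation.Theorems.RobustLoudUpgrade.ScalingCrossing

open Literature.Analysis.FunctionSpaces Literature.Analysis.FunctionSpaces.Torus
open Literature.Analysis.FunctionSpaces.EuclideanSpace
open Literature.Analysis.FluidPDE
open Summit.AnomalousDissipation.AnomalousDissipation.Theses.BaireTransfer
open Summit.AnomalousDissipation.AnomalousDissipation.Theorems.RobustLoudUpgrade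

/-! ## The registered stub -/

/-- **Registered stub `stub_radialSteady`** (class R, steady): radial visibility `f_c ∉ range L(ν,u₀)` of a simply
degenerate mean-zero steady state gives a Lyapunov–Schmidt function `σ` on `P_S × ℝ` whose zeros near `(c,0)` are
realised by mean-zero classical steady states of the UNCORRECTED forces `f_{q.1}`, `H¹`-near `u₀`, and which changes
sign along the ray `s ↦ σ(s • c, 0)` at dilation factors arbitrarily close to `1` (`LsFamily.stub_lsFamily` with
border `h := f_c`; the visibility test gives `∂ₛσ(s • c, 0)|ₛ₌₁ = Dσ(c,0)(c,0) ≠ 0`). [folklore] -/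
theorem stub_radialSteady : ∀ (S : Finset (Fin 3 → ℤ)) (c : Coeff S) (ν : ℝ) (u₀ : UnitAddTorus (Fin 3) → EuclideanSpace ℝ (Fin 3)) (p₀ : UnitAddTorus (Fin 3) → ℝ) (v : UnitAddTorus (Fin 3) → EuclideanSpace ℝ (Fin 3)), 0 < ν → Torus.IsSteadyNSState ν (force S c) u₀ p₀ → HasZeroMean u₀ → IsSmooth v → IsDivFree v → HasZeroMean v → (∀ w, Torus.LinNSResolventRel ν u₀ 0 w 0 → ∃ z : ℂ, w = z • cplx v) → (∀ w, ¬ Torus.LinNSResolventRel ν u₀ 0 w (cplx (force S c))) → ∃ σ : Coeff S × ℝ → ℝ, (∀ δ : ℝ, 0 < δ → ∃ r : ℝ, 0 < r ∧ ContinuousOn σ (Metric.ball (c, (0 : ℝ)) r) ∧ ∀ q ∈ Metric.ball (c, (0 : ℝ)) r, σ q = 0 → ∃ (u' : UnitAddTorus (Fin 3) → EuclideanSpace ℝ (Fin 3)) (p' : UnitAddTorus (Fin 3) → ℝ), Torus.IsSteadyNSState ν (force S q.1) u' p' ∧ HasZeroMean u' ∧ h1DistSq u' u₀ < δ) ∧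 ∀ η : ℝ, 0 < η → ∃ s₁ s₂ : ℝ, |s₁ - 1| < η ∧ |s₂ - 1| < η ∧ σ (s₁ • c, 0) < 0 ∧ 0 < σ (s₂ • c, 0) := by
  intro S c ν u₀ p₀ v hν hst h0 hv₁ hv₂ hv₃ hker hvis
  -- the Lyapunov–Schmidt family bordered by the force itself
  obtain ⟨σ, hσ0, ⟨ℓ, hσℓ, -, hℓvis⟩, hreal, -⟩ :=
    LsFamily.stub_lsFamily S c ν u₀ p₀ v (force S c) hν hst h0 hv₁ hv₂ hv₃ hker
      (SteadyPersist.isSmooth_force' c) (SteadyPersist.isDivFree_force' c) (SteadyPersist.hasZeroMean_force' c)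
      hvis
  -- the visibility test in the radial direction
  have hm : ℓ (c, 0) ≠ 0 := hℓvis c hvis
  refine ⟨σ, ?_, ?_⟩
  · -- (A) family at zeros: the corrected force `f_{q.1} - σ q • f_c` is `f_{q.1}` when `σ q = 0`
    intro δ hδ
    obtain ⟨r, hr, hcont, hball⟩ := hreal δ hδ
    refine ⟨r, hr, hcont, fun q hq hq0 => ?_⟩
    obtain ⟨-, u', p', hst', hmean', hdist', -, -⟩ := hball q hq
    have e : (fun y => force S q.1 y - σ q • force S c y) = force S q.1 := by
      funext y
      rw [hq0, zero_smul, sub_zero]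
    rw [e] at hst'
    exact ⟨u', p', hst', hmean', hdist'⟩
  · -- (B) sign change along the ray `s ↦ σ (s • c, 0)` through the simple zero `s = 1` (derivative `ℓ (c, 0) ≠ 0`)
    intro η hη
    exact exists_ray_sign_change hσ0 hσℓ hm hη

end Summit.AnomalousDissipation.AnomalousDissipation.Theorems.RobustLoudUpgrade.ScalingCrossing

end
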